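import Literature.NumberTheory.EllipticCurves.X049SupersingularPrimes
import Literature.NumberTheory.EllipticCurves.X049GroupOrderHoldsProofs
import HarnessLib

/-!
# Rajwade 1977, Theorem 3, for the whole family `y² = x(x² + 21Dx + 112D²)`: `N_p = p + 1 − (D/p)·((u/7)·u)` at `4p = u² + 7v²`,
# `N_p = p + 1` at `p ≡ 3, 5, 6 (mod 7)` — from the `D = 1` case

Topic `Literature/NumberTheory/EllipticCurves`, namespace `Literature.NumberTheory.EllipticCurves.X049` (sequel to `X049TwistFamily`).  THEOREMS ONLY.
Rajwade's Theorem 3 (J. Austral. Math. Soc. A 24 (1977), p. 290), VERBATIM up to notation: for the curve (0.1) `y² = x(x² + 21Dx + 112D²)` and a good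
prime `p ∤ 14D`,
«`N_p = p + 1` if `p` is not a norm, i.e. if `p ≡ 3, 5, 13 (mod 14)`; `N_p = p + 1 − (D/π)₂π − (D/π̄)₂π̄` if `p` is a norm, i.e. if `p ≡ 1, 9, 11 (mod 14)`,
where `p = ππ̄` … and `π, π̄` are normalized so that `π, π̄ ≡ 1, 2 or 4 (mod √−7)`» — here with `π = ½(u + v√−7)`, `(D/π)₂ = (D/π̄)₂ = (D/p)`,
`π + π̄ = u`, normalisation `(u/7) = 1`, on the tree's `ℤ`-model `cm28Codomain D = [0, 21D, 0, 112D², 0]` and its point count `numPointsMod`: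

* `numPointsMod_cm28Codomain_of_inert` — the first clause, UNCONDITIONAL (`X049SupersingularPrimes`), for square-free `D`, `p ∤ 14D`;
* `numPointsMod_cm28Codomain_of_groupOrder` — the second clause for every square-free `D` and `p ∤ 14D`, MODULO its `D = 1` instance
  `X049.groupOrder_A7` (Silverberg 2010 (2.1)): the `D`-dependence `(D/p)` is the kernel theorem `lFunction_apply_prime_twist` (twist law).

So the named fact `groupOrder_A7` (stated for `49a1 ≅ E'_1` only) carries the whole printed theorem.  Nothing about BSD is proved here.

## References
* A. R. Rajwade, J. Austral. Math. Soc. A 24 (1977), Thm. 3. [Rajwade1977]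
* A. Silverberg, Contemp. Math. 521 (2010), (2.1). [Silverberg2010]
-/

noncomputable section

open scoped Classical NumberTheorySymbols

namespace Literature.NumberTheory.EllipticCurves

namespace X049

open _root_.WeierstrassCurve Literature.NumberTheory.Automorphic Literature.NumberTheory.QuadraticFields

/-- **Rajwade's Theorem 3, first clause, UNCONDITIONAL**: `N_p = p + 1` for the curve `y² = x(x² + 21Dx + 112D²)` (`D` square-free) at every prime
`p ∤ 14D` with `p ≡ 3, 5, 6 (mod 7)` («`p` is not a norm, i.e. `p ≡ 3, 5, 13 (mod 14)`»). [cite: Rajwade1977, Thm 3] -/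
theorem numPointsMod_cm28Codomain_of_inert {D : ℤ} (hsq : Squarefree D) {p : ℕ} (hp : p.Prime) (hp2 : p ≠ 2) (hpD : ¬ (p : ℤ) ∣ 7 * D)
    (hp7 : p % 7 = 3 ∨ p % 7 = 5 ∨ p % 7 = 6) : (numPointsMod (cm28Codomain D) p : ℤ) = p + 1 := by
  have h := lFunction_apply_prime_eq_zero_cm28Codomain hsq hp hp7
  rw [lFunction_map_apply_prime_of_not_dvd _ hp (not_dvd_Δ_cm28Codomain hp hp2 hpD), Automorphic.frobeniusTrace] at h
  linarith

/-- **Rajwade's Theorem 3, second clause, for every square-free `D`**: at a prime `p ∤ 14D` with `4p = u² + 7v²` and `u` normalised by `(u/7) = 1`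
(«`π, π̄ ≡ 1, 2 or 4 (mod √−7)`», `π = ½(u + v√−7)`), `N_p = p + 1 − (D/p)·u` (`= p + 1 − (D/π)₂π − (D/π̄)₂π̄`), MODULO the `D = 1` instance
`groupOrder_A7`; the factor `(D/p)` is the kernel twist law `lFunction_apply_prime_twist`. [cite: Rajwade1977, Thm 3] [cite: Silverberg2010, (2.1)] -/
theorem numPointsMod_cm28Codomain_of_groupOrder (hG : groupOrder_A7) {D : ℤ} {p : ℕ} (hp : p.Prime) (hp2 : p ≠ 2)
    (hpD : ¬ (p : ℤ) ∣ 7 * D) {u v : ℤ} (huv : u ^ 2 + 7 * v ^ 2 = 4 * p) (hu : J(u | 7) = 1) :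
    (numPointsMod (cm28Codomain D) p : ℤ) = p + 1 - J(D | p) * u := by
  have hp7 : p ≠ 7 := by rintro rfl; exact hpD ⟨D, by ring⟩
  have h := lFunction_apply_prime_twist (d := D) hp hp2 hpD
  rw [lFunction_map_apply_prime_of_not_dvd _ hp (not_dvd_Δ_cm28Codomain hp hp2 hpD), lFunction_apply_prime_of_groupOrder hG hp hp7 huv,
    hu, one_mul, Automorphic.frobeniusTrace] at h
  linarith

/-- The same without the normalisation of `u`: `N_p = p + 1 − (D/p)·(u/7)·u` for ANY `u, v` with `4p = u² + 7v²` (Silverberg's form, `(2u/7) = (u/7)`).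
[cite: Silverberg2010, (2.1)] [cite: Rajwade1977, Thm 3] -/
theorem numPointsMod_cm28Codomain_of_groupOrder' (hG : groupOrder_A7) {D : ℤ} {p : ℕ} (hp : p.Prime) (hp2 : p ≠ 2)
    (hpD : ¬ (p : ℤ) ∣ 7 * D) {u v : ℤ} (huv : u ^ 2 + 7 * v ^ 2 = 4 * p) :
    (numPointsMod (cm28Codomain D) p : ℤ) = p + 1 - J(D | p) * (J(u | 7) * u) := by
  have hp7 : p ≠ 7 := by rintro rfl; exact hpD ⟨D, by ring⟩
  have h := lFunction_apply_prime_twist (d := D) hp hp2 hpD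
  rw [lFunction_map_apply_prime_of_not_dvd _ hp (not_dvd_Δ_cm28Codomain hp hp2 hpD), lFunction_apply_prime_of_groupOrder hG hp hp7 huv,
    Automorphic.frobeniusTrace] at h
  linarith

/-! ### Appendix (after `X049GroupOrderHoldsProofs`): the same, UNCONDITIONALLY

`groupOrder_A7` is now a theorem of the tree (`groupOrder_A7_holds`: the formula up to sign from Deuring, `groupOrder_A7_iff_sign`, and the sign
`a_p ≡ p² + p⁵ (mod 7)` by the `√−7`-torsion Frobenius argument, `X049SevenTorsionFrobenius`), so Rajwade's Theorem 3 holds for the whole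
family with no hypothesis left. -/

/-- ★ **Rajwade 1977, Theorem 3 — both clauses, for every `D`, UNCONDITIONALLY** (second clause): at a prime `p ∤ 14D` with `4p = u² + 7v²` and
`(u/7) = 1`, `N_p(y² = x(x² + 21Dx + 112D²)) = p + 1 − (D/p)·u`.  (First clause: `numPointsMod_cm28Codomain_of_inert`.) [cite: Rajwade1977, Thm 3] -/
theorem rajwadeThree_numPointsMod {D : ℤ} {p : ℕ} (hp : p.Prime) (hp2 : p ≠ 2) (hpD : ¬ (p : ℤ) ∣ 7 * D) {u v : ℤ}
    (huv : u ^ 2 + 7 * v ^ 2 = 4 * p) (hu : J(u | 7) = 1) : (numPointsMod (cm28Codomain D) p : ℤ) = p + 1 - J(D | p) * u :=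
  numPointsMod_cm28Codomain_of_groupOrder groupOrder_A7_holds hp hp2 hpD huv hu

/-- The same without normalising `u`: `N_p = p + 1 − (D/p)·(u/7)·u` for ANY `u, v` with `4p = u² + 7v²`, unconditionally (Silverberg's form).
[cite: Silverberg2010, (2.1)] [cite: Rajwade1977, Thm 3] -/
theorem rajwadeThree_numPointsMod' {D : ℤ} {p : ℕ} (hp : p.Prime) (hp2 : p ≠ 2) (hpD : ¬ (p : ℤ) ∣ 7 * D) {u v : ℤ}
    (huv : u ^ 2 + 7 * v ^ 2 = 4 * p) : (numPointsMod (cm28Codomain D) p : ℤ) = p + 1 - J(D | p) * (J(u | 7) * u) :=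
  numPointsMod_cm28Codomain_of_groupOrder' groupOrder_A7_holds hp hp2 hpD huv

/-- **`a_p(49a1) = (u/7)·u` whenever `4p = u² + 7v²`, `p ≠ 7`** (`D = 1`, `E = 49a1 ≅ E'_1`; Rajwade's normalised `π + π̄`), unconditionally.
[cite: Rajwade1977, Thm 3] [cite: Silverberg2010, (2.1)] -/
theorem lFunction_apply_prime_eq_jacobiSym_mul {p : ℕ} (hp : p.Prime) (hp7 : p ≠ 7) {u v : ℤ} (huv : u ^ 2 + 7 * v ^ 2 = 4 * p) :
    (E.map (Int.castRingHom ℚ)).LFunction p = J(u | 7) * u :=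
  lFunction_apply_prime_of_groupOrder groupOrder_A7_holds hp hp7 huv

/-- **`a_p(E'_D) = (D/p)·(u/7)·u` whenever `4p = u² + 7v²`, `p ∤ 14D`** — the Frobenius trace of the whole family in closed form, unconditionally
(twist law `lFunction_apply_prime_twist` and the `D = 1` case). [cite: Rajwade1977, Thm 3] -/
theorem lFunction_apply_prime_cm28Codomain_eq {D : ℤ} {p : ℕ} (hp : p.Prime) (hp2 : p ≠ 2) (hpD : ¬ (p : ℤ) ∣ 7 * D) {u v : ℤ}
    (huv : u ^ 2 + 7 * v ^ 2 = 4 * p) : ((cm28Codomain D).map (Int.castRingHom ℚ)).LFunction p = J(D | p) * (J(u | 7) * u) := by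
  have hp7 : p ≠ 7 := by rintro rfl; exact hpD ⟨D, by ring⟩
  rw [lFunction_apply_prime_twist (d := D) hp hp2 hpD, lFunction_apply_prime_eq_jacobiSym_mul hp hp7 huv]

end X049

end Literature.NumberTheory.EllipticCurves

end
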